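import Mathlib

/-!
# BlochSeedDiscOne — the dual-certificate family (lens `dual`, g2): TWO-SIDED TRADE LAW, SUPPLY BOUNDS, TOP-SHIFT COVARIANCE

Companion to `DualCertificateLaw.lean` (g0: law (R), one-sided law, `Q`-word) and `DualCertificateLawBand.lean` (g1: the thirteen
balances, line collapse, type table with `ctot`, supply law, λ-law, NO-SUPPLIER theorem).  Evidence-grade kernel facts (`ring` /
`decide` / finite sums over `ℚ`) about the CLASS side of the pad-4 frame; nothing in this file is a step toward `HC`, `HC_CM`, `HC_AV`,
crux ℤ4/26512/18881/H2 — seats produce evidence and typed files, not rungs.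

## What is certified here (all `h`, all bands: no census enters the hypotheses)

* §1 PAYLOAD AND BALANCE OF PAYMENTS.  With the per-column payload `π_k := V_k·(3 − cS_k)` on fully charged line columns (`FC`) and
  `π_k := 3·v̂_k` elsewhere, g1's supply law is the single identity `Σ_K a_k π_k = 0` (`payments_balance`): signed supply is conserved.
  A SUPPLIER is a column with `a_k π_k > 0` (N-unbalanced FC, N-mixed with `v̂ > 0`, P-mixed with `v̂ < 0`), a CONSUMER one with `a_k π_k < 0`.
* §2 THE TWO-SIDED TRADE LAW (answers the director's «Re μ ≡ 0 on every band-b support» in its true, h-uniform form).  If a support has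
  NO SUPPLIER (`a π ≤ 0` columnwise) OR NO CONSUMER (`a π ≥ 0` columnwise) then every column trades zero (`trade_zero_oneSided`), hence every
  unbalanced FC column and every contentful mixed column is massless (`massless_oneSided`), hence `Im μ = Σ_FC a V ι = 0` AND
  `Re μ = Σ_FC a V ε = 0` (`im_dead_oneSided`, `re_dead_oneSided`; the Re half uses the `S`-balance once more: `ε = cS/3` on what is left).
  So `μ ≠ 0` needs a supplier AND a consumer in the support; by law (R) `Re μ ≠ 0` needs in addition `T₂` mass, `Im μ ≠ 0` odd mass.
* §3 SUPPLY BOUNDS (quantitative form).  With `Π := Σ_K |a_k π_k|` (= twice the total supply, `abs_trade_eq_two_supply`):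
  `|Im μ| ≤ Π/3` (`im_bound`) and `|Re μ| ≤ 2Π/3` (`re_bound`); the type inequalities used (`|ι| ≤ 1`, `ι ≠ 0 → cS = 0`, `cS = 3 → ε = 1`,
  `|3ε − cS| ≤ 2(3 − cS)`) are `decide`d over the 256 phase vectors (`typeFactsTrade`).
* §4 TOP-SHIFT COVARIANCE OF THE THIRTEEN BALANCES.  Under the letter shift `σ : (a, β) ↦ (a + 2, β)` (LINE-h → LINE-(h+2), band b at h →
  band b at h+2; `α ↦ α + 2`, `p = α² − r² ↦ p + 4α + 4`, `r, c, d` fixed, `μ`-words fixed) the thirteen (H1) functionals of g1 transform by a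
  UNIPOTENT INTEGER matrix (13 `ring` identities `D2_shift … Rpp_shift`; `D2, R11, RS` and the two t-free contents `D4b − 2D4a`, `Ruu − R1p` are
  invariant): the clean cone is shift-equivariant (`clean_shift`: balances vanish at h ⇒ the shifted balances vanish), with the same `μ`.
  This is the DESIGN-side companion of `StrengthenTopShift.lean` (strengthen g4: the class LATTICE is shift-covariant by a binomial transform).

Census instances — the nine universes (12; 0,2,4,6,8), (14; 0,4,6), (16; 0), the shift/inclusion MONOTONICITY of statics (15 universe pairs,
0 columns SAT → UNSAT; the realised supports M72 (12,4) and T65 (14,0) stay JOINTLY static under σ and under band inclusion: σM72 at (14,4),(14,6),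
σT65 at (16,0), M72 ⊂ (12,6),(12,8), T65 ⊂ (14,4),(14,6) — so by §4 their clean designs transport with the same `μ`), the (14,0) Re-DEAD theorem at
static level (14/14 `T₂`-anchored and 16/16 supplier-anchored compatibility LPs = 0) and the realised Im-alive (14,0) support T65 — are DATA in the
memo `DUAL-CERT-FAMILY-g2.md`, not kernel facts.

STANDALONE: §A restates VERBATIM the definitions of g1's `DualCertificateLawBand.lean` that are used below (the 17 placement sums, `D2…D6`,
the line/general letters `αL, pL, pG`, the type coordinates `reI, imI, eps, iota, cS`) inside this file's namespace, so that the file elaborates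
against Mathlib alone (the Cruxes modules are workfiles, not built library targets); the originals and their census provenance are g1's.
-/

set_option linter.dupNamespace false

namespace Summit.HodgeConjecture.HodgeConjecture.Cruxes.BlochSeedDiscOne.DualLawFamily

/-! ## §A Definitions restated from g1 (`DualLawBand`, verbatim) -/
section restated
variable {R : Type*} [CommRing R]

/-- placement sum (over the 24 orderings of the cell) of the word `111p`. -/
def W111p (p : Fin 4 → R) : R :=
    p 3 + p 2 + p 3 + p 1 +
    p 2 + p 1 + p 3 + p 2 +
    p 3 + p 0 + p 2 + p 0 +
    p 3 + p 1 + p 3 + p 0 +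
    p 1 + p 0 + p 2 + p 1 +
    p 2 + p 0 + p 1 + p 0
/-- placement sum of `11uu`. -/
def W11uu (α : Fin 4 → R) : R :=
    α 2 * α 3 + α 3 * α 2 + α 1 * α 3 + α 3 * α 1 +
    α 1 * α 2 + α 2 * α 1 + α 2 * α 3 + α 3 * α 2 +
    α 0 * α 3 + α 3 * α 0 + α 0 * α 2 + α 2 * α 0 +
    α 1 * α 3 + α 3 * α 1 + α 0 * α 3 + α 3 * α 0 +
    α 0 * α 1 + α 1 * α 0 + α 1 * α 2 + α 2 * α 1 +
    α 0 * α 2 + α 2 * α 0 + α 0 * α 1 + α 1 * α 0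
/-- placement sum of `11up`. -/
def W11up (α : Fin 4 → R) (p : Fin 4 → R) : R :=
    α 2 * p 3 + α 3 * p 2 + α 1 * p 3 + α 3 * p 1 +
    α 1 * p 2 + α 2 * p 1 + α 2 * p 3 + α 3 * p 2 +
    α 0 * p 3 + α 3 * p 0 + α 0 * p 2 + α 2 * p 0 +
    α 1 * p 3 + α 3 * p 1 + α 0 * p 3 + α 3 * p 0 +
    α 0 * p 1 + α 1 * p 0 + α 1 * p 2 + α 2 * p 1 +
    α 0 * p 2 + α 2 * p 0 + α 0 * p 1 + α 1 * p 0
/-- placement sum of `1uuu`. -/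
def W1uuu (α : Fin 4 → R) : R :=
    α 1 * α 2 * α 3 + α 1 * α 3 * α 2 + α 2 * α 1 * α 3 + α 2 * α 3 * α 1 +
    α 3 * α 1 * α 2 + α 3 * α 2 * α 1 + α 0 * α 2 * α 3 + α 0 * α 3 * α 2 +
    α 2 * α 0 * α 3 + α 2 * α 3 * α 0 + α 3 * α 0 * α 2 + α 3 * α 2 * α 0 +
    α 0 * α 1 * α 3 + α 0 * α 3 * α 1 + α 1 * α 0 * α 3 + α 1 * α 3 * α 0 +
    α 3 * α 0 * α 1 + α 3 * α 1 * α 0 + α 0 * α 1 * α 2 + α 0 * α 2 * α 1 +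
    α 1 * α 0 * α 2 + α 1 * α 2 * α 0 + α 2 * α 0 * α 1 + α 2 * α 1 * α 0
/-- placement sum of `11pp`. -/
def W11pp (p : Fin 4 → R) : R :=
    p 2 * p 3 + p 3 * p 2 + p 1 * p 3 + p 3 * p 1 +
    p 1 * p 2 + p 2 * p 1 + p 2 * p 3 + p 3 * p 2 +
    p 0 * p 3 + p 3 * p 0 + p 0 * p 2 + p 2 * p 0 +
    p 1 * p 3 + p 3 * p 1 + p 0 * p 3 + p 3 * p 0 +
    p 0 * p 1 + p 1 * p 0 + p 1 * p 2 + p 2 * p 1 +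
    p 0 * p 2 + p 2 * p 0 + p 0 * p 1 + p 1 * p 0
/-- placement sum of `1uup`. -/
def W1uup (α : Fin 4 → R) (p : Fin 4 → R) : R :=
    α 1 * α 2 * p 3 + α 1 * α 3 * p 2 + α 2 * α 1 * p 3 + α 2 * α 3 * p 1 +
    α 3 * α 1 * p 2 + α 3 * α 2 * p 1 + α 0 * α 2 * p 3 + α 0 * α 3 * p 2 +
    α 2 * α 0 * p 3 + α 2 * α 3 * p 0 + α 3 * α 0 * p 2 + α 3 * α 2 * p 0 +
    α 0 * α 1 * p 3 + α 0 * α 3 * p 1 + α 1 * α 0 * p 3 + α 1 * α 3 * p 0 +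
    α 3 * α 0 * p 1 + α 3 * α 1 * p 0 + α 0 * α 1 * p 2 + α 0 * α 2 * p 1 +
    α 1 * α 0 * p 2 + α 1 * α 2 * p 0 + α 2 * α 0 * p 1 + α 2 * α 1 * p 0
/-- placement sum of `uuuu`. -/
def Wuuuu (α : Fin 4 → R) : R :=
    α 0 * α 1 * α 2 * α 3 + α 0 * α 1 * α 3 * α 2 + α 0 * α 2 * α 1 * α 3 + α 0 * α 2 * α 3 * α 1 +
    α 0 * α 3 * α 1 * α 2 + α 0 * α 3 * α 2 * α 1 + α 1 * α 0 * α 2 * α 3 + α 1 * α 0 * α 3 * α 2 +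
    α 1 * α 2 * α 0 * α 3 + α 1 * α 2 * α 3 * α 0 + α 1 * α 3 * α 0 * α 2 + α 1 * α 3 * α 2 * α 0 +
    α 2 * α 0 * α 1 * α 3 + α 2 * α 0 * α 3 * α 1 + α 2 * α 1 * α 0 * α 3 + α 2 * α 1 * α 3 * α 0 +
    α 2 * α 3 * α 0 * α 1 + α 2 * α 3 * α 1 * α 0 + α 3 * α 0 * α 1 * α 2 + α 3 * α 0 * α 2 * α 1 +
    α 3 * α 1 * α 0 * α 2 + α 3 * α 1 * α 2 * α 0 + α 3 * α 2 * α 0 * α 1 + α 3 * α 2 * α 1 * α 0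
/-- placement sum of `1upp`. -/
def W1upp (α : Fin 4 → R) (p : Fin 4 → R) : R :=
    α 1 * p 2 * p 3 + α 1 * p 3 * p 2 + α 2 * p 1 * p 3 + α 2 * p 3 * p 1 +
    α 3 * p 1 * p 2 + α 3 * p 2 * p 1 + α 0 * p 2 * p 3 + α 0 * p 3 * p 2 +
    α 2 * p 0 * p 3 + α 2 * p 3 * p 0 + α 3 * p 0 * p 2 + α 3 * p 2 * p 0 +
    α 0 * p 1 * p 3 + α 0 * p 3 * p 1 + α 1 * p 0 * p 3 + α 1 * p 3 * p 0 +
    α 3 * p 0 * p 1 + α 3 * p 1 * p 0 + α 0 * p 1 * p 2 + α 0 * p 2 * p 1 +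
    α 1 * p 0 * p 2 + α 1 * p 2 * p 0 + α 2 * p 0 * p 1 + α 2 * p 1 * p 0
/-- placement sum of `uuup`. -/
def Wuuup (α : Fin 4 → R) (p : Fin 4 → R) : R :=
    α 0 * α 1 * α 2 * p 3 + α 0 * α 1 * α 3 * p 2 + α 0 * α 2 * α 1 * p 3 + α 0 * α 2 * α 3 * p 1 +
    α 0 * α 3 * α 1 * p 2 + α 0 * α 3 * α 2 * p 1 + α 1 * α 0 * α 2 * p 3 + α 1 * α 0 * α 3 * p 2 +
    α 1 * α 2 * α 0 * p 3 + α 1 * α 2 * α 3 * p 0 + α 1 * α 3 * α 0 * p 2 + α 1 * α 3 * α 2 * p 0 +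
    α 2 * α 0 * α 1 * p 3 + α 2 * α 0 * α 3 * p 1 + α 2 * α 1 * α 0 * p 3 + α 2 * α 1 * α 3 * p 0 +
    α 2 * α 3 * α 0 * p 1 + α 2 * α 3 * α 1 * p 0 + α 3 * α 0 * α 1 * p 2 + α 3 * α 0 * α 2 * p 1 +
    α 3 * α 1 * α 0 * p 2 + α 3 * α 1 * α 2 * p 0 + α 3 * α 2 * α 0 * p 1 + α 3 * α 2 * α 1 * p 0
/-- placement sum of `1ppp`. -/
def W1ppp (p : Fin 4 → R) : R :=
    p 1 * p 2 * p 3 + p 1 * p 3 * p 2 + p 2 * p 1 * p 3 + p 2 * p 3 * p 1 +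
    p 3 * p 1 * p 2 + p 3 * p 2 * p 1 + p 0 * p 2 * p 3 + p 0 * p 3 * p 2 +
    p 2 * p 0 * p 3 + p 2 * p 3 * p 0 + p 3 * p 0 * p 2 + p 3 * p 2 * p 0 +
    p 0 * p 1 * p 3 + p 0 * p 3 * p 1 + p 1 * p 0 * p 3 + p 1 * p 3 * p 0 +
    p 3 * p 0 * p 1 + p 3 * p 1 * p 0 + p 0 * p 1 * p 2 + p 0 * p 2 * p 1 +
    p 1 * p 0 * p 2 + p 1 * p 2 * p 0 + p 2 * p 0 * p 1 + p 2 * p 1 * p 0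
/-- placement sum of `uupp`. -/
def Wuupp (α : Fin 4 → R) (p : Fin 4 → R) : R :=
    α 0 * α 1 * p 2 * p 3 + α 0 * α 1 * p 3 * p 2 + α 0 * α 2 * p 1 * p 3 + α 0 * α 2 * p 3 * p 1 +
    α 0 * α 3 * p 1 * p 2 + α 0 * α 3 * p 2 * p 1 + α 1 * α 0 * p 2 * p 3 + α 1 * α 0 * p 3 * p 2 +
    α 1 * α 2 * p 0 * p 3 + α 1 * α 2 * p 3 * p 0 + α 1 * α 3 * p 0 * p 2 + α 1 * α 3 * p 2 * p 0 +
    α 2 * α 0 * p 1 * p 3 + α 2 * α 0 * p 3 * p 1 + α 2 * α 1 * p 0 * p 3 + α 2 * α 1 * p 3 * p 0 +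
    α 2 * α 3 * p 0 * p 1 + α 2 * α 3 * p 1 * p 0 + α 3 * α 0 * p 1 * p 2 + α 3 * α 0 * p 2 * p 1 +
    α 3 * α 1 * p 0 * p 2 + α 3 * α 1 * p 2 * p 0 + α 3 * α 2 * p 0 * p 1 + α 3 * α 2 * p 1 * p 0
/-- placement sum of `Re⟨11eē⟩`: the factor `Re(β_iβ̄_j)` of the pair placed at `e,ē` is written `r_i r_j c_ij`. -/
def R11 (r : Fin 4 → R) (c : Fin 4 → Fin 4 → R) : R :=
    r 2 * r 3 * c 2 3 + r 3 * r 2 * c 3 2 + r 1 * r 3 * c 1 3 + r 3 * r 1 * c 3 1 +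
    r 1 * r 2 * c 1 2 + r 2 * r 1 * c 2 1 + r 2 * r 3 * c 2 3 + r 3 * r 2 * c 3 2 +
    r 0 * r 3 * c 0 3 + r 3 * r 0 * c 3 0 + r 0 * r 2 * c 0 2 + r 2 * r 0 * c 2 0 +
    r 1 * r 3 * c 1 3 + r 3 * r 1 * c 3 1 + r 0 * r 3 * c 0 3 + r 3 * r 0 * c 3 0 +
    r 0 * r 1 * c 0 1 + r 1 * r 0 * c 1 0 + r 1 * r 2 * c 1 2 + r 2 * r 1 * c 2 1 +
    r 0 * r 2 * c 0 2 + r 2 * r 0 * c 2 0 + r 0 * r 1 * c 0 1 + r 1 * r 0 * c 1 0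
/-- placement sum of `Re⟨1ueē⟩`. -/
def R1u (α : Fin 4 → R) (r : Fin 4 → R) (c : Fin 4 → Fin 4 → R) : R :=
    α 1 * r 2 * r 3 * c 2 3 + α 1 * r 3 * r 2 * c 3 2 + α 2 * r 1 * r 3 * c 1 3 + α 2 * r 3 * r 1 * c 3 1 +
    α 3 * r 1 * r 2 * c 1 2 + α 3 * r 2 * r 1 * c 2 1 + α 0 * r 2 * r 3 * c 2 3 + α 0 * r 3 * r 2 * c 3 2 +
    α 2 * r 0 * r 3 * c 0 3 + α 2 * r 3 * r 0 * c 3 0 + α 3 * r 0 * r 2 * c 0 2 + α 3 * r 2 * r 0 * c 2 0 +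
    α 0 * r 1 * r 3 * c 1 3 + α 0 * r 3 * r 1 * c 3 1 + α 1 * r 0 * r 3 * c 0 3 + α 1 * r 3 * r 0 * c 3 0 +
    α 3 * r 0 * r 1 * c 0 1 + α 3 * r 1 * r 0 * c 1 0 + α 0 * r 1 * r 2 * c 1 2 + α 0 * r 2 * r 1 * c 2 1 +
    α 1 * r 0 * r 2 * c 0 2 + α 1 * r 2 * r 0 * c 2 0 + α 2 * r 0 * r 1 * c 0 1 + α 2 * r 1 * r 0 * c 1 0
/-- placement sum of `Re⟨1pēe⟩` (word `1eēp`). -/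
def R1p (p : Fin 4 → R) (r : Fin 4 → R) (c : Fin 4 → Fin 4 → R) : R :=
    p 1 * r 2 * r 3 * c 2 3 + p 1 * r 3 * r 2 * c 3 2 + p 2 * r 1 * r 3 * c 1 3 + p 2 * r 3 * r 1 * c 3 1 +
    p 3 * r 1 * r 2 * c 1 2 + p 3 * r 2 * r 1 * c 2 1 + p 0 * r 2 * r 3 * c 2 3 + p 0 * r 3 * r 2 * c 3 2 +
    p 2 * r 0 * r 3 * c 0 3 + p 2 * r 3 * r 0 * c 3 0 + p 3 * r 0 * r 2 * c 0 2 + p 3 * r 2 * r 0 * c 2 0 +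
    p 0 * r 1 * r 3 * c 1 3 + p 0 * r 3 * r 1 * c 3 1 + p 1 * r 0 * r 3 * c 0 3 + p 1 * r 3 * r 0 * c 3 0 +
    p 3 * r 0 * r 1 * c 0 1 + p 3 * r 1 * r 0 * c 1 0 + p 0 * r 1 * r 2 * c 1 2 + p 0 * r 2 * r 1 * c 2 1 +
    p 1 * r 0 * r 2 * c 0 2 + p 1 * r 2 * r 0 * c 2 0 + p 2 * r 0 * r 1 * c 0 1 + p 2 * r 1 * r 0 * c 1 0
/-- placement sum of `Re⟨uueē⟩`. -/
def Ruu (α : Fin 4 → R) (r : Fin 4 → R) (c : Fin 4 → Fin 4 → R) : R :=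
    α 0 * α 1 * r 2 * r 3 * c 2 3 + α 0 * α 1 * r 3 * r 2 * c 3 2 + α 0 * α 2 * r 1 * r 3 * c 1 3 + α 0 * α 2 * r 3 * r 1 * c 3 1 +
    α 0 * α 3 * r 1 * r 2 * c 1 2 + α 0 * α 3 * r 2 * r 1 * c 2 1 + α 1 * α 0 * r 2 * r 3 * c 2 3 + α 1 * α 0 * r 3 * r 2 * c 3 2 +
    α 1 * α 2 * r 0 * r 3 * c 0 3 + α 1 * α 2 * r 3 * r 0 * c 3 0 + α 1 * α 3 * r 0 * r 2 * c 0 2 + α 1 * α 3 * r 2 * r 0 * c 2 0 +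
    α 2 * α 0 * r 1 * r 3 * c 1 3 + α 2 * α 0 * r 3 * r 1 * c 3 1 + α 2 * α 1 * r 0 * r 3 * c 0 3 + α 2 * α 1 * r 3 * r 0 * c 3 0 +
    α 2 * α 3 * r 0 * r 1 * c 0 1 + α 2 * α 3 * r 1 * r 0 * c 1 0 + α 3 * α 0 * r 1 * r 2 * c 1 2 + α 3 * α 0 * r 2 * r 1 * c 2 1 +
    α 3 * α 1 * r 0 * r 2 * c 0 2 + α 3 * α 1 * r 2 * r 0 * c 2 0 + α 3 * α 2 * r 0 * r 1 * c 0 1 + α 3 * α 2 * r 1 * r 0 * c 1 0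
/-- placement sum of `Re⟨upeē⟩` (word `ueēp`). -/
def Rup (α : Fin 4 → R) (p : Fin 4 → R) (r : Fin 4 → R) (c : Fin 4 → Fin 4 → R) : R :=
    α 0 * p 1 * r 2 * r 3 * c 2 3 + α 0 * p 1 * r 3 * r 2 * c 3 2 + α 0 * p 2 * r 1 * r 3 * c 1 3 + α 0 * p 2 * r 3 * r 1 * c 3 1 +
    α 0 * p 3 * r 1 * r 2 * c 1 2 + α 0 * p 3 * r 2 * r 1 * c 2 1 + α 1 * p 0 * r 2 * r 3 * c 2 3 + α 1 * p 0 * r 3 * r 2 * c 3 2 +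
    α 1 * p 2 * r 0 * r 3 * c 0 3 + α 1 * p 2 * r 3 * r 0 * c 3 0 + α 1 * p 3 * r 0 * r 2 * c 0 2 + α 1 * p 3 * r 2 * r 0 * c 2 0 +
    α 2 * p 0 * r 1 * r 3 * c 1 3 + α 2 * p 0 * r 3 * r 1 * c 3 1 + α 2 * p 1 * r 0 * r 3 * c 0 3 + α 2 * p 1 * r 3 * r 0 * c 3 0 +
    α 2 * p 3 * r 0 * r 1 * c 0 1 + α 2 * p 3 * r 1 * r 0 * c 1 0 + α 3 * p 0 * r 1 * r 2 * c 1 2 + α 3 * p 0 * r 2 * r 1 * c 2 1 +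
    α 3 * p 1 * r 0 * r 2 * c 0 2 + α 3 * p 1 * r 2 * r 0 * c 2 0 + α 3 * p 2 * r 0 * r 1 * c 0 1 + α 3 * p 2 * r 1 * r 0 * c 1 0
/-- placement sum of `Re⟨ppeē⟩` (word `eēpp`). -/
def Rpp (p : Fin 4 → R) (r : Fin 4 → R) (c : Fin 4 → Fin 4 → R) : R :=
    p 0 * p 1 * r 2 * r 3 * c 2 3 + p 0 * p 1 * r 3 * r 2 * c 3 2 + p 0 * p 2 * r 1 * r 3 * c 1 3 + p 0 * p 2 * r 3 * r 1 * c 3 1 +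
    p 0 * p 3 * r 1 * r 2 * c 1 2 + p 0 * p 3 * r 2 * r 1 * c 2 1 + p 1 * p 0 * r 2 * r 3 * c 2 3 + p 1 * p 0 * r 3 * r 2 * c 3 2 +
    p 1 * p 2 * r 0 * r 3 * c 0 3 + p 1 * p 2 * r 3 * r 0 * c 3 0 + p 1 * p 3 * r 0 * r 2 * c 0 2 + p 1 * p 3 * r 2 * r 0 * c 2 0 +
    p 2 * p 0 * r 1 * r 3 * c 1 3 + p 2 * p 0 * r 3 * r 1 * c 3 1 + p 2 * p 1 * r 0 * r 3 * c 0 3 + p 2 * p 1 * r 3 * r 0 * c 3 0 +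
    p 2 * p 3 * r 0 * r 1 * c 0 1 + p 2 * p 3 * r 1 * r 0 * c 1 0 + p 3 * p 0 * r 1 * r 2 * c 1 2 + p 3 * p 0 * r 2 * r 1 * c 2 1 +
    p 3 * p 1 * r 0 * r 2 * c 0 2 + p 3 * p 1 * r 2 * r 0 * c 2 0 + p 3 * p 2 * r 0 * r 1 * c 0 1 + p 3 * p 2 * r 1 * r 0 * c 1 0
/-- placement sum of `Re⟨eeēē⟩`: the factor `Re(β_aβ_bβ̄_iβ̄_j)` is written `r_a r_b r_i r_j d_ab` with `d_ab = d_ij` the value of the split `{a,b}|{i,j}`. -/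
def RS (r : Fin 4 → R) (d : Fin 4 → Fin 4 → R) : R :=
    r 0 * r 1 * r 2 * r 3 * d 0 1 + r 0 * r 1 * r 3 * r 2 * d 0 1 + r 0 * r 2 * r 1 * r 3 * d 0 2 + r 0 * r 2 * r 3 * r 1 * d 0 2 +
    r 0 * r 3 * r 1 * r 2 * d 0 3 + r 0 * r 3 * r 2 * r 1 * d 0 3 + r 1 * r 0 * r 2 * r 3 * d 1 0 + r 1 * r 0 * r 3 * r 2 * d 1 0 +
    r 1 * r 2 * r 0 * r 3 * d 1 2 + r 1 * r 2 * r 3 * r 0 * d 1 2 + r 1 * r 3 * r 0 * r 2 * d 1 3 + r 1 * r 3 * r 2 * r 0 * d 1 3 +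
    r 2 * r 0 * r 1 * r 3 * d 2 0 + r 2 * r 0 * r 3 * r 1 * d 2 0 + r 2 * r 1 * r 0 * r 3 * d 2 1 + r 2 * r 1 * r 3 * r 0 * d 2 1 +
    r 2 * r 3 * r 0 * r 1 * d 2 3 + r 2 * r 3 * r 1 * r 0 * d 2 3 + r 3 * r 0 * r 1 * r 2 * d 3 0 + r 3 * r 0 * r 2 * r 1 * d 3 0 +
    r 3 * r 1 * r 0 * r 2 * d 3 1 + r 3 * r 1 * r 2 * r 0 * d 3 1 + r 3 * r 2 * r 0 * r 1 * d 3 2 + r 3 * r 2 * r 1 * r 0 * d 3 2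

/-- `D2 = 11uu − 111p` (×24). -/ def D2 (α p : Fin 4 → R) : R := W11uu α - W111p p
/-- `D3 = 1uuu − 11up` (×24). -/ def D3 (α p : Fin 4 → R) : R := W1uuu α - W11up α p
/-- `D4a = 1uup − 11pp` (×24). -/ def D4a (α p : Fin 4 → R) : R := W1uup α p - W11pp p
/-- `D4b = uuuu − 11pp` (×24). -/ def D4b (α p : Fin 4 → R) : R := Wuuuu α - W11pp p
/-- `D5 = uuup − 1upp` (×24). -/ def D5 (α p : Fin 4 → R) : R := Wuuup α p - W1upp α p
/-- `D6 = uupp − 1ppp` (×24). -/ def D6 (α p : Fin 4 → R) : R := Wuupp α p - W1ppp p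


/-- line letters: `α_j = t − r_j`. -/ def αL (t : R) (r : Fin 4 → R) : Fin 4 → R := fun j => t - r j
/-- line letters: `p_j = α_j² − r_j² = t² − 2 t r_j`. -/ def pL (t : R) (r : Fin 4 → R) : Fin 4 → R := fun j => t ^ 2 - 2 * t * r j


/-- general letters: `p_j = α_j² − r_j²`. -/ def pG (α r : Fin 4 → R) : Fin 4 → R := fun j => α j ^ 2 - r j ^ 2


end restated

/-- `Re (i^n)`. -/ def reI (n : ZMod 4) : ℤ := if n = 0 then 1 else if n = 2 then -1 else 0
/-- `Im (i^n)`. -/ def imI (n : ZMod 4) : ℤ := if n = 1 then 1 else if n = 3 then -1 else 0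
/-- `ε`: `Re μ̂ / V`. -/ def eps (k : Fin 4 → ZMod 4) : ℤ := reI (k 0 + k 1 + k 2 + k 3)
/-- `ι`: `Im μ̂ / V`. -/ def iota (k : Fin 4 → ZMod 4) : ℤ := imI (k 0 + k 1 + k 2 + k 3)
/-- `cS`: `ŝ / V`, sum over the three `2|2` splits of `Re i^{k_a+k_b−k_i−k_j}`. -/
def cS (k : Fin 4 → ZMod 4) : ℤ := reI (k 0 + k 1 - k 2 - k 3) + reI (k 0 + k 2 - k 1 - k 3) + reI (k 0 + k 3 - k 1 - k 2)


/-! ## §0 Type facts used by the trade law and the bounds (fully charged cells, phases `k : Fin 4 → ZMod 4`) -/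

/-- For every fully charged type: `|ι| ≤ 1`; odd (`ι ≠ 0`) ⇒ `cS = 0`; balanced (`cS = 3`) ⇒ `ε = 1`; and the Re-bound inequality
`|3ε − cS| ≤ 2·(3 − cS)` (equality exactly on `(0011)`/`(0123)`, where `ε − cS/3 = −4/3`). -/
theorem typeFactsTrade : ∀ a b c d : ZMod 4,
    let k : Fin 4 → ZMod 4 := ![a, b, c, d]
    |iota k| ≤ 1 ∧ (iota k ≠ 0 → cS k = 0) ∧ (cS k = 3 → eps k = 1) ∧ |3 * eps k - cS k| ≤ 2 * (3 - cS k) := by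
  unfold eps iota cS reI imI
  simp only [Fin.isValue, Matrix.cons_val_zero]
  decide

section trade
variable {ι : Type*} [DecidableEq ι]
open Finset

/-! ## §1 Payload and balance of payments -/

/-- per-column PAYLOAD: `V·(3 − cS)` on fully charged line columns, `3·v̂` on the others. -/
def payload (FC : Finset ι) (v V cS3 : ι → ℚ) (k : ι) : ℚ := if k ∈ FC then V k * (3 - cS3 k) else 3 * v k

theorem payload_of_mem {FC : Finset ι} {v V cS3 : ι → ℚ} {k : ι} (hk : k ∈ FC) : payload FC v V cS3 k = V k * (3 - cS3 k) := by
  simp [payload, hk]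

theorem payload_of_not_mem {FC : Finset ι} {v V cS3 : ι → ℚ} {k : ι} (hk : k ∉ FC) : payload FC v V cS3 k = 3 * v k := by
  simp [payload, hk]

/-- BALANCE OF PAYMENTS: on a clean design the signed payloads sum to zero (g1's supply law in conserved form). -/
theorem payments_balance (K FC : Finset ι) (hFC : FC ⊆ K) (a v s V cS3 : ι → ℚ)
    (hv : ∀ k ∈ FC, v k = V k) (hs : ∀ k ∈ FC, s k = V k * cS3 k) (hs0 : ∀ k ∈ K \ FC, s k = 0)
    (hV : ∑ k ∈ K, a k * v k = 0) (hS : ∑ k ∈ K, a k * s k = 0) :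
    ∑ k ∈ K, a k * payload FC v V cS3 k = 0 := by
  rw [← Finset.sum_sdiff hFC]
  have splitV := Finset.sum_sdiff hFC (f := fun k => a k * v k)
  have splitS := Finset.sum_sdiff hFC (f := fun k => a k * s k)
  rw [hV] at splitV; rw [hS] at splitS
  have hS0 : ∑ k ∈ K \ FC, a k * s k = 0 := Finset.sum_eq_zero (fun k hk => by rw [hs0 k hk]; ring)
  have hFCv : ∑ k ∈ FC, a k * v k = ∑ k ∈ FC, a k * V k := Finset.sum_congr rfl (fun k hk => by rw [hv k hk])
  have hFCs : ∑ k ∈ FC, a k * s k = ∑ k ∈ FC, a k * V k * cS3 k := Finset.sum_congr rfl (fun k hk => by rw [hs k hk]; ring)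
  have h1 : ∑ k ∈ K \ FC, a k * payload FC v V cS3 k = 3 * ∑ k ∈ K \ FC, a k * v k := by
    rw [Finset.mul_sum]
    refine Finset.sum_congr rfl (fun k hk => ?_)
    rw [payload_of_not_mem (Finset.mem_sdiff.1 hk).2]; ring
  have h2 : ∑ k ∈ FC, a k * payload FC v V cS3 k = 3 * ∑ k ∈ FC, a k * V k - ∑ k ∈ FC, a k * V k * cS3 k := by
    rw [Finset.mul_sum, ← Finset.sum_sub_distrib]
    exact Finset.sum_congr rfl (fun k hk => by rw [payload_of_mem hk]; ring)
  rw [h1, h2]; linarith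

/-! ## §2 The two-sided trade law -/

omit [DecidableEq ι] in
/-- a finite family summing to zero whose terms are all `≤ 0` or all `≥ 0` vanishes termwise. -/
theorem trade_zero_oneSided (K : Finset ι) (f : ι → ℚ) (hsum : ∑ k ∈ K, f k = 0)
    (h : (∀ k ∈ K, f k ≤ 0) ∨ (∀ k ∈ K, 0 ≤ f k)) : ∀ k ∈ K, f k = 0 := by
  rcases h with h | h
  · exact (Finset.sum_eq_zero_iff_of_nonpos h).1 hsum
  · exact (Finset.sum_eq_zero_iff_of_nonneg h).1 hsum

/-- NO SUPPLIER or NO CONSUMER ⇒ every unbalanced FC column (`cS < 3`, `V > 0`) and every contentful mixed column (`v̂ ≠ 0`) is massless. -/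
theorem massless_oneSided (K FC : Finset ι) (hFC : FC ⊆ K) (a v s V cS3 : ι → ℚ)
    (hv : ∀ k ∈ FC, v k = V k) (hs : ∀ k ∈ FC, s k = V k * cS3 k) (hs0 : ∀ k ∈ K \ FC, s k = 0)
    (hV : ∑ k ∈ K, a k * v k = 0) (hS : ∑ k ∈ K, a k * s k = 0) (hVpos : ∀ k ∈ FC, 0 < V k)
    (h1 : (∀ k ∈ K, a k * payload FC v V cS3 k ≤ 0) ∨ (∀ k ∈ K, 0 ≤ a k * payload FC v V cS3 k)) :
    (∀ k ∈ FC, cS3 k < 3 → a k = 0) ∧ (∀ k ∈ K \ FC, v k ≠ 0 → a k = 0) := by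
  have zero := trade_zero_oneSided K _ (payments_balance K FC hFC a v s V cS3 hv hs hs0 hV hS) h1
  refine ⟨fun k hk h3 => ?_, fun k hk hvk => ?_⟩
  · have hz := zero k (hFC hk)
    rw [payload_of_mem hk] at hz
    have hpos : 0 < V k * (3 - cS3 k) := mul_pos (hVpos k hk) (by linarith)
    rcases mul_eq_zero.1 hz with h | h
    · exact h
    · exact absurd h (ne_of_gt hpos)
  · have hz := zero k (Finset.mem_sdiff.1 hk).1
    rw [payload_of_not_mem (Finset.mem_sdiff.1 hk).2] at hz
    rcases mul_eq_zero.1 hz with h | h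
    · exact h
    · exfalso; exact hvk (by linarith)

/-- … hence `Im μ = Σ_FC a·V·ι = 0` (odd types are unbalanced). -/
theorem im_dead_oneSided (K FC : Finset ι) (hFC : FC ⊆ K) (a v s V cS3 iota3 : ι → ℚ)
    (hv : ∀ k ∈ FC, v k = V k) (hs : ∀ k ∈ FC, s k = V k * cS3 k) (hs0 : ∀ k ∈ K \ FC, s k = 0)
    (hV : ∑ k ∈ K, a k * v k = 0) (hS : ∑ k ∈ K, a k * s k = 0) (hVpos : ∀ k ∈ FC, 0 < V k)
    (hodd : ∀ k ∈ FC, iota3 k ≠ 0 → cS3 k = 0)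
    (h1 : (∀ k ∈ K, a k * payload FC v V cS3 k ≤ 0) ∨ (∀ k ∈ K, 0 ≤ a k * payload FC v V cS3 k)) :
    ∑ k ∈ FC, a k * V k * iota3 k = 0 := by
  have massless := (massless_oneSided K FC hFC a v s V cS3 hv hs hs0 hV hS hVpos h1).1
  apply Finset.sum_eq_zero
  intro k hk
  by_cases hi : iota3 k = 0
  · simp [hi]
  · have := massless k hk (by rw [hodd k hk hi]; norm_num)
    simp [this]

/-- … AND `Re μ = Σ_FC a·V·ε = 0`: what survives is balanced (`cS = 3`, `ε = 1`) and the `S`-balance `Σ_FC a·V·cS = 0` kills it.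
This is the h-uniform content of «Re μ ≡ 0»: true on every support without a supplier (or without a consumer), at every `h` and band. -/
theorem re_dead_oneSided (K FC : Finset ι) (hFC : FC ⊆ K) (a v s V cS3 eps3 : ι → ℚ)
    (hv : ∀ k ∈ FC, v k = V k) (hs : ∀ k ∈ FC, s k = V k * cS3 k) (hs0 : ∀ k ∈ K \ FC, s k = 0)
    (hV : ∑ k ∈ K, a k * v k = 0) (hS : ∑ k ∈ K, a k * s k = 0) (hVpos : ∀ k ∈ FC, 0 < V k)
    (hcS : ∀ k ∈ FC, cS3 k ≤ 3) (hbal : ∀ k ∈ FC, cS3 k = 3 → eps3 k = 1)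
    (h1 : (∀ k ∈ K, a k * payload FC v V cS3 k ≤ 0) ∨ (∀ k ∈ K, 0 ≤ a k * payload FC v V cS3 k)) :
    ∑ k ∈ FC, a k * V k * eps3 k = 0 := by
  have massless := (massless_oneSided K FC hFC a v s V cS3 hv hs hs0 hV hS hVpos h1).1
  -- the S-balance restricted to FC
  have splitS := Finset.sum_sdiff hFC (f := fun k => a k * s k)
  rw [hS] at splitS
  have hS0 : ∑ k ∈ K \ FC, a k * s k = 0 := Finset.sum_eq_zero (fun k hk => by rw [hs0 k hk]; ring)
  have hFCs : ∑ k ∈ FC, a k * s k = ∑ k ∈ FC, a k * V k * cS3 k := Finset.sum_congr rfl (fun k hk => by rw [hs k hk]; ring)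
  have sbal : ∑ k ∈ FC, a k * V k * cS3 k = 0 := by linarith
  -- termwise `a V ε = (1/3) a V cS`
  have key : ∀ k ∈ FC, a k * V k * eps3 k = (1/3 : ℚ) * (a k * V k * cS3 k) := by
    intro k hk
    by_cases h3 : cS3 k < 3
    · simp [massless k hk h3]
    · have e3 : cS3 k = 3 := le_antisymm (hcS k hk) (not_lt.1 h3)
      rw [hbal k hk e3, e3]; ring
  rw [Finset.sum_congr rfl key, ← Finset.mul_sum, sbal]; ring

/-! ## §3 Supply bounds -/

omit [DecidableEq ι] in
/-- `Σ |a π| = 2 · (total supply)`: with `Σ a π = 0`, the absolute trade is twice its positive part. -/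
theorem abs_trade_eq_two_supply (K : Finset ι) (f : ι → ℚ) (hsum : ∑ k ∈ K, f k = 0) :
    ∑ k ∈ K, |f k| = 2 * ∑ k ∈ K, max (f k) 0 := by
  have h : ∀ k ∈ K, |f k| = 2 * max (f k) 0 - f k := by
    intro k _
    rcases le_total 0 (f k) with hk | hk
    · rw [abs_of_nonneg hk, max_eq_left hk]; ring
    · rw [abs_of_nonpos hk, max_eq_right hk]; ring
  rw [Finset.sum_congr rfl h, Finset.sum_sub_distrib, ← Finset.mul_sum, hsum]; ring

/-- `|Im μ| ≤ (1/3)·Σ_K |a π|`: odd columns have `cS = 0`, so their payload is `3V ≥ 3V|ι|`. -/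
theorem im_bound (K FC : Finset ι) (hFC : FC ⊆ K) (a v V cS3 iota3 : ι → ℚ)
    (hVnn : ∀ k ∈ FC, 0 ≤ V k) (hι : ∀ k ∈ FC, |iota3 k| ≤ 1) (hodd : ∀ k ∈ FC, iota3 k ≠ 0 → cS3 k = 0) :
    |∑ k ∈ FC, a k * V k * iota3 k| ≤ (1/3 : ℚ) * ∑ k ∈ K, |a k * payload FC v V cS3 k| := by
  have step1 : |∑ k ∈ FC, a k * V k * iota3 k| ≤ ∑ k ∈ FC, |a k * V k * iota3 k| := Finset.abs_sum_le_sum_abs _ _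
  have step2 : ∀ k ∈ FC, |a k * V k * iota3 k| ≤ (1/3 : ℚ) * |a k * payload FC v V cS3 k| := by
    intro k hk
    by_cases hi : iota3 k = 0
    · simp [hi]; positivity
    · rw [payload_of_mem hk, hodd k hk hi]
      have hV := hVnn k hk
      rw [abs_mul, abs_mul, abs_mul, abs_of_nonneg hV]
      have : |(3 : ℚ) - 0| = 3 := by norm_num
      rw [abs_mul, abs_of_nonneg hV, this]
      have hιk := hι k hk
      have hprod : 0 ≤ |a k| * V k := mul_nonneg (abs_nonneg _) hV
      nlinarith [mul_le_mul_of_nonneg_left hιk hprod, hprod]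
  have step3 : ∑ k ∈ FC, |a k * V k * iota3 k| ≤ ∑ k ∈ FC, (1/3 : ℚ) * |a k * payload FC v V cS3 k| := Finset.sum_le_sum step2
  have step4 : ∑ k ∈ FC, (1/3 : ℚ) * |a k * payload FC v V cS3 k| ≤ ∑ k ∈ K, (1/3 : ℚ) * |a k * payload FC v V cS3 k| :=
    Finset.sum_le_sum_of_subset_of_nonneg hFC (fun k _ _ => by positivity)
  rw [Finset.mul_sum]
  linarith

/-- `|Re μ| ≤ (2/3)·Σ_K |a π|`: by the `S`-balance `Re μ = Σ_FC a·V·(ε − cS/3)`, and `|3ε − cS| ≤ 2(3 − cS)` typewise. -/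
theorem re_bound (K FC : Finset ι) (hFC : FC ⊆ K) (a v s V cS3 eps3 : ι → ℚ)
    (hs : ∀ k ∈ FC, s k = V k * cS3 k) (hs0 : ∀ k ∈ K \ FC, s k = 0) (hS : ∑ k ∈ K, a k * s k = 0)
    (hVnn : ∀ k ∈ FC, 0 ≤ V k) (hcS : ∀ k ∈ FC, cS3 k ≤ 3) (htype : ∀ k ∈ FC, |3 * eps3 k - cS3 k| ≤ 2 * (3 - cS3 k)) :
    |∑ k ∈ FC, a k * V k * eps3 k| ≤ (2/3 : ℚ) * ∑ k ∈ K, |a k * payload FC v V cS3 k| := by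
  have splitS := Finset.sum_sdiff hFC (f := fun k => a k * s k)
  rw [hS] at splitS
  have hS0 : ∑ k ∈ K \ FC, a k * s k = 0 := Finset.sum_eq_zero (fun k hk => by rw [hs0 k hk]; ring)
  have hFCs : ∑ k ∈ FC, a k * s k = ∑ k ∈ FC, a k * V k * cS3 k := Finset.sum_congr rfl (fun k hk => by rw [hs k hk]; ring)
  have sbal : ∑ k ∈ FC, a k * V k * cS3 k = 0 := by linarith
  have rewrite : ∑ k ∈ FC, a k * V k * eps3 k = ∑ k ∈ FC, (1/3 : ℚ) * (a k * V k * (3 * eps3 k - cS3 k)) := by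
    have : ∑ k ∈ FC, (1/3 : ℚ) * (a k * V k * (3 * eps3 k - cS3 k)) = ∑ k ∈ FC, a k * V k * eps3 k - (1/3 : ℚ) * ∑ k ∈ FC, a k * V k * cS3 k := by
      rw [Finset.mul_sum, ← Finset.sum_sub_distrib]; exact Finset.sum_congr rfl (fun k _ => by ring)
    rw [this, sbal]; ring
  rw [rewrite]
  have step1 : |∑ k ∈ FC, (1/3 : ℚ) * (a k * V k * (3 * eps3 k - cS3 k))| ≤ ∑ k ∈ FC, |(1/3 : ℚ) * (a k * V k * (3 * eps3 k - cS3 k))| :=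
    Finset.abs_sum_le_sum_abs _ _
  have step2 : ∀ k ∈ FC, |(1/3 : ℚ) * (a k * V k * (3 * eps3 k - cS3 k))| ≤ (2/3 : ℚ) * |a k * payload FC v V cS3 k| := by
    intro k hk
    rw [payload_of_mem hk]
    have hV := hVnn k hk; have h3 : 0 ≤ 3 - cS3 k := by linarith [hcS k hk]
    rw [abs_mul, abs_mul, abs_mul, abs_of_nonneg hV, abs_mul, abs_mul, abs_of_nonneg hV, abs_of_nonneg h3]
    have ht := htype k hk
    have : |(1/3 : ℚ)| = 1/3 := by norm_num
    rw [this]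
    nlinarith [abs_nonneg (a k), mul_nonneg (abs_nonneg (a k)) hV]
  have step3 := Finset.sum_le_sum step2
  have step4 : ∑ k ∈ FC, (2/3 : ℚ) * |a k * payload FC v V cS3 k| ≤ ∑ k ∈ K, (2/3 : ℚ) * |a k * payload FC v V cS3 k| :=
    Finset.sum_le_sum_of_subset_of_nonneg hFC (fun k _ _ => by positivity)
  rw [Finset.mul_sum]
  linarith

end trade

/-! ## §4 Top-shift covariance of the thirteen balances (`α ↦ α + 2`, `p ↦ p + 4α + 4`; `r, c, d` and the `μ`-words fixed) -/

section shift
variable {R : Type*} [CommRing R]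

/-- shifted tops: `α_j ↦ α_j + 2`. -/ def αS (α : Fin 4 → R) : Fin 4 → R := fun j => α j + 2
/-- shifted `p`: `p_j ↦ p_j + 4 α_j + 4` (= `(α_j+2)² − r_j²` when `p_j = α_j² − r_j²`). -/
def pS (α p : Fin 4 → R) : Fin 4 → R := fun j => p j + 4 * α j + 4

/-- consistency with g1's general letters `pG α r = α² − r²`. -/
theorem pS_pG (α r : Fin 4 → R) : pG (αS α) r = pS α (pG α r) := by
  funext j; simp only [pG, αS, pS]; ring

/-- consistency with g1's line letters: shifting the line `t` by 2. -/
theorem αS_line (t : R) (r : Fin 4 → R) : αS (αL t r) = αL (t + 2) r := by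
  funext j; simp only [αS, αL]; ring
theorem pS_line (t : R) (r : Fin 4 → R) : pS (αL t r) (pL t r) = pL (t + 2) r := by
  funext j; simp only [pS, αL, pL]; ring

theorem D2_shift (α p : Fin 4 → R) : D2 (αS α) (pS α p) = D2 α p := by
  simp only [D2, W11uu, W111p, αS, pS]; ring

theorem D3_shift (α p : Fin 4 → R) : D3 (αS α) (pS α p) = D3 α p + 2 * D2 α p := by
  simp only [D3, D2, W1uuu, W11up, W11uu, W111p, αS, pS]; ring

theorem D4a_shift (α p : Fin 4 → R) : D4a (αS α) (pS α p) = D4a α p + 4 * D3 α p + 4 * D2 α p := by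
  simp only [D4a, D3, D2, W1uup, W11pp, W1uuu, W11up, W11uu, W111p, αS, pS]; ring

theorem D4b_shift (α p : Fin 4 → R) : D4b (αS α) (pS α p) = D4b α p + 8 * D3 α p + 8 * D2 α p := by
  simp only [D4b, D3, D2, Wuuuu, W11pp, W1uuu, W11up, W11uu, W111p, αS, pS]; ring

theorem D5_shift (α p : Fin 4 → R) :
    D5 (αS α) (pS α p) = D5 α p + 4 * D4b α p - 2 * D4a α p + 12 * D3 α p + 8 * D2 α p := by
  simp only [D5, D4b, D4a, D3, D2, Wuuup, W1upp, Wuuuu, W11pp, W1uup, W1uuu, W11up, W11uu, W111p, αS, pS]; ring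

theorem D6_shift (α p : Fin 4 → R) :
    D6 (αS α) (pS α p) = D6 α p + 8 * D5 α p + 16 * D4b α p - 8 * D4a α p + 32 * D3 α p + 16 * D2 α p := by
  simp only [D6, D5, D4b, D4a, D3, D2, Wuupp, W1ppp, Wuuup, W1upp, Wuuuu, W11pp, W1uup, W1uuu, W11up, W11uu, W111p, αS, pS]; ring

theorem R1u_shift (α r : Fin 4 → R) (c : Fin 4 → Fin 4 → R) : R1u (αS α) r c = R1u α r c + 2 * R11 r c := by
  simp only [R1u, R11, αS]; ring

theorem R1p_shift (α p r : Fin 4 → R) (c : Fin 4 → Fin 4 → R) :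
    R1p (pS α p) r c = R1p p r c + 4 * R1u α r c + 4 * R11 r c := by
  simp only [R1p, R1u, R11, pS]; ring

theorem Ruu_shift (α r : Fin 4 → R) (c : Fin 4 → Fin 4 → R) :
    Ruu (αS α) r c = Ruu α r c + 4 * R1u α r c + 4 * R11 r c := by
  simp only [Ruu, R1u, R11, αS]; ring

theorem Rup_shift (α p r : Fin 4 → R) (c : Fin 4 → Fin 4 → R) :
    Rup (αS α) (pS α p) r c = Rup α p r c + 4 * Ruu α r c + 2 * R1p p r c + 12 * R1u α r c + 8 * R11 r c := by
  simp only [Rup, Ruu, R1p, R1u, R11, αS, pS]; ring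

theorem Rpp_shift (α p r : Fin 4 → R) (c : Fin 4 → Fin 4 → R) :
    Rpp (pS α p) r c = Rpp p r c + 8 * Rup α p r c + 16 * Ruu α r c + 8 * R1p p r c + 32 * R1u α r c + 16 * R11 r c := by
  simp only [Rpp, Rup, Ruu, R1p, R1u, R11, pS]; ring

/-! `R11 r c` and `RS r d` do not see `α, p`: invariant by definition.  The two t-free contents are shift-INVARIANT: -/
theorem vContent_shift (α p : Fin 4 → R) :
    D4b (αS α) (pS α p) - 2 * D4a (αS α) (pS α p) = D4b α p - 2 * D4a α p := by
  rw [D4b_shift, D4a_shift]; ring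

theorem ctContent_shift (α p r : Fin 4 → R) (c : Fin 4 → Fin 4 → R) :
    Ruu (αS α) r c - R1p (pS α p) r c = Ruu α r c - R1p p r c := by
  rw [Ruu_shift, R1p_shift]; ring

end shift

/-! ### Clean-cone equivariance (abstract form).  If the shifted row functionals are a fixed linear recombination of the unshifted ones
(§4: unipotent integer matrix, the same for every column), then a design clean for the rows is clean for the shifted rows. -/
theorem clean_shift {ι : Type*} (K : Finset ι) (x : ι → ℚ) (m : ℕ) (b b' : Fin m → ι → ℚ) (U : Fin m → Fin m → ℚ)
    (hU : ∀ i k, b' i k = ∑ j, U i j * b j k) (hclean : ∀ j, ∑ k ∈ K, x k * b j k = 0) :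
    ∀ i, ∑ k ∈ K, x k * b' i k = 0 := by
  intro i
  calc ∑ k ∈ K, x k * b' i k = ∑ k ∈ K, ∑ j, U i j * (x k * b j k) := by
        refine Finset.sum_congr rfl (fun k _ => ?_)
        rw [hU i k, Finset.mul_sum]
        exact Finset.sum_congr rfl (fun j _ => by ring)
    _ = ∑ j, ∑ k ∈ K, U i j * (x k * b j k) := Finset.sum_comm
    _ = ∑ j, U i j * ∑ k ∈ K, x k * b j k := by
        refine Finset.sum_congr rfl (fun j _ => ?_)
        rw [Finset.mul_sum]
    _ = 0 := by simp [hclean]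

end Summit.HodgeConjecture.HodgeConjecture.Cruxes.BlochSeedDiscOne.DualLawFamily
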